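import Summits.RiemannHypothesis.RiemannHypothesis.Theorems.TiltedLandingLaw421R3FLinkGain

/-! # FLinkGainSeam — the SEAM-BINDERED twin of the box gain socket (C4 W-09, answer to C3 g53 RESULT-2 (S))

C3 g53 RESULT-2 (S): the typed gain sockets `RhW08.FLink.FLinkBoxSig' θ` (LAND #1237 §3′) and `RhW08.FLinkGain.RemainderGainBoxSig θ` (LAND of
`…R3FLinkGain`) carry NO level-`j` seam binder, while their sink `RhW08.FLink.FarFieldModulusLawBoxPl` DOES (`LevelRemainderBox η f x₀ s hmax R j`,
its 9th binder), and every bench of the gain law imposes exactly that seam as legality — so the model evidence supports the SEAM-BINDERED law.  This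
file types that law on the C4 side and proves it is ALL the plumbed sink needs:
* (T, OPEN) `RemainderGainBoxSeamSig θ` = `RemainderGainBoxSig θ` with the seam binder `LevelRemainderBox η f x₀ s hmax R j →` inserted exactly
  where `FarFieldModulusLawBoxPl` has it (after the two box binders); conclusion written through `RhW08.FLinkGain.lineRem` (desk RB3: `Iff.rfl` with
  the spelled-out form).  WEAKER than `RemainderGainBoxSig θ` (one more hypothesis): `remainderGainBoxSeam_of_remainderGainBox`.
* ★ (K) `farFieldModulusLawBoxPl_of_remainderGainBoxSeam : RemainderGainBoxSeamSig θ → FarFieldModulusLawBoxPl (1 + θ)` — the seam hypothesis is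
  used TWICE: transported to the line point by #1237's `lineRemainderAt_of_levelRemainderBox`, and handed to the gain law; the `1/m` identity
  (`norm_farFieldAt_le_norm_lineRem`) is the child-side leg.  Hence the NAMED SINK `tModAllowanceBoxPl_of_remainderGainBoxSeam` (`0 ≤ θ`, `(1+θ)² ≤ 5/4`).
Honest reading: the socket is a HYPOTHESIS (typed OPEN), implied by nothing proved; this file only shows that the weakest benched form of the gain
law already feeds the plumbed sink.  Sorry-free; no type-class declarations, no custom syntax, no option changes.  Nothing here bears on the truth of
RH; RH is NOT proved; ⟨33346⟩/⟨33347⟩ OPEN; checked ≠ landed ≠ proved. -/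

noncomputable section

namespace RhW08.FLinkGainSeam

open Complex Filter Topology
open scoped ComplexConjugate
open RhW08.Round1 RhW08.StSwap RhW08.Round2 RhW08.QuadW
open RhW08.SealSwap (PBot)
open RhW08.SealSwapQ RhW08.RateSplit RhW08.IsolatedTilt RhW08.FarStep RhW08.BurgersRate RhW08.PurseP RhW08.BurgersRateG3
open RhIdea6.G17.W07C7 RhIdea6.G17.W07C7.Rev6 RhIdea6.G18.W07C8.Law421BirthS RhIdea6.G19.W07C11.Seam
open RhIdea6.G20.W07C12.Frac RhIdea6.G20.W07C12.StColP RhW07.C12.FieldSplit RhIdea6.G21.W07C13.TentMax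
open RhW07.C14.TwoSided RhW07.C14.Classes RhW07.C14.Lineage RhW07.C14.Booking
open RhW08.FLink RhW08.FLinkGain

/-- (T, OPEN) **REMAINDER GAIN LAW, BOX- AND SEAM-BINDERED** `RemainderGainBoxSeamSig θ`: `RemainderGainBoxSig θ`'s binders with the level-`j` seam
`LevelRemainderBox η f x₀ s hmax R j` as one more hypothesis, placed as in `FarFieldModulusLawBoxPl`; conclusion: the line remainder grows by at most
`θ·η/s` from the line point to the child, `‖lineRem f j v R w‖ ≤ ‖lineRem f j v R (linePt v w)‖ + θ·η/s`. -/
def RemainderGainBoxSeamSig (θ : ℝ) : Prop :=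
  ∀ (η : ℝ) (f : ℂ → ℂ) (x₀ s hmax R Hs : ℝ) (B : ℕ), EngineHyps5 2 η f x₀ s hmax R Hs B →
    ∀ (j : ℕ) (v w : ℂ), FarLevelQ η f x₀ s hmax R Hs B j → Charged (PTrkSQ PBot) StTrkDQ ReadyR2 η f x₀ s hmax R Hs B j →
      IsLowest StTrkDQ η f x₀ s hmax R Hs B j v → |v.re - x₀| ≤ R / 2 → v.im ≤ hmax → LevelRemainderBox η f x₀ s hmax R j →
      iteratedDeriv j f w ≠ 0 → (∀ z : ℂ, iteratedDeriv j f z = 0 → |z.re - v.re| < R / 2 → z = v ∨ z = conj v) →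
      iteratedDeriv (j + 1) f w = 0 → 0 < w.im → ‖w - (v.re : ℂ)‖ ≤ |v.im| →
        ‖lineRem f j v R w‖ ≤ ‖lineRem f j v R (linePt v w)‖ + θ * η / s

/-- (K) add one binder: the box gain law implies its seam-bindered twin (the seam hypothesis is simply not used). -/
theorem remainderGainBoxSeam_of_remainderGainBox {θ : ℝ} (h : RemainderGainBoxSig θ) : RemainderGainBoxSeamSig θ := by
  intro η f x₀ s hmax R Hs B hE j v w hfar hch hlow hcol hh _hRB hw0 hiso hw1 hwim hdisc
  exact h η f x₀ s hmax R Hs B hE j v w hfar hch hlow hcol hh hw0 hiso hw1 hwim hdisc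

/-- (K) … and so does the unrestricted gain law `RemainderGainSig θ`. -/
theorem remainderGainBoxSeam_of_remainderGain {θ : ℝ} (h : RemainderGainSig θ) : RemainderGainBoxSeamSig θ :=
  remainderGainBoxSeam_of_remainderGainBox (remainderGainBox_of_remainderGain h)

/-- ★ (K, PROVED) **THE SEAM-BINDERED GAIN LAW ALONE GIVES THE PLUMBED BOX MODULUS LAW at `λ = 1 + θ`**: at the line point the seam gives
`‖lineRem (linePt v w)‖ ≤ η/s` (#1237's `lineRemainderAt_of_levelRemainderBox`), at the child `‖farFieldAt‖ ≤ ‖lineRem‖` (the `1/m` identity), and the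
gain law joins them. -/
theorem farFieldModulusLawBoxPl_of_remainderGainBoxSeam {θ : ℝ} (hG : RemainderGainBoxSeamSig θ) : FarFieldModulusLawBoxPl (1 + θ) := by
  intro η f x₀ s hmax R Hs B hE j v w hfar hch hlow hcol hh hRB hw0 hiso hw1 hwim hdisc
  have h0 : ‖lineRem f j v R (linePt v w)‖ ≤ η / s :=
    lineRemainderAt_of_levelRemainderBox hE hRB hlow hcol hh hw0 hiso hwim hdisc
  have hv : StColQ' η f x₀ s hmax R Hs B j v := hlow.1
  obtain ⟨-, hFv, hv0, -⟩ := hv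
  have h1 : ‖farFieldAt f j v w‖ ≤ ‖lineRem f j v R w‖ := norm_farFieldAt_le_norm_lineRem hE hFv hv0 hiso hw0 hw1
  have h2 : ‖lineRem f j v R w‖ ≤ ‖lineRem f j v R (linePt v w)‖ + θ * η / s :=
    hG η f x₀ s hmax R Hs B hE j v w hfar hch hlow hcol hh hRB hw0 hiso hw1 hwim hdisc
  have h3 : (1 + θ) * η / s = η / s + θ * η / s := by ring
  rw [h3]
  linarith

/-- (K) … hence the NAMED SINK `TModAllowanceBoxPlSig` from the seam-bindered gain law alone (`0 ≤ θ`, `(1+θ)² ≤ 5/4`, i.e. `θ ≤ √(5/4) − 1 ≈ 0.118`). -/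
theorem tModAllowanceBoxPl_of_remainderGainBoxSeam {θ : ℝ} (hG : RemainderGainBoxSeamSig θ) (hθ : 0 ≤ θ) (hθ2 : (1 + θ) ^ 2 ≤ 5 / 4) :
    TModAllowanceBoxPlSig :=
  ⟨1 + θ, by linarith, hθ2, farFieldModulusLawBoxPl_of_remainderGainBoxSeam hG⟩

/-- (K) monotonicity in the allowance: a smaller `θ` gives a stronger law (uses only `0 < s` and `0 ≤ η` of the frame). -/
theorem remainderGainBoxSeamSig_mono {θ θ' : ℝ} (hle : θ ≤ θ') (h : RemainderGainBoxSeamSig θ) : RemainderGainBoxSeamSig θ' := by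
  intro η f x₀ s hmax R Hs B hE j v w hfar hch hlow hcol hh hRB hw0 hiso hw1 hwim hdisc
  have h1 := h η f x₀ s hmax R Hs B hE j v w hfar hch hlow hcol hh hRB hw0 hiso hw1 hwim hdisc
  obtain ⟨_, _, _, hs, _, _, _, _, _, _, _, _, _, hη, _, _⟩ := hE
  have h2 : θ * η / s ≤ θ' * η / s := by
    apply div_le_div_of_nonneg_right _ hs.le
    exact mul_le_mul_of_nonneg_right hle hη
  linarith

end RhW08.FLinkGainSeam

end
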